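import Summits.HodgeConjecture.HodgeConjecture.Theorems.MarkmanPartnerTransportPicardThreeK3SquaresNikulinIsogeny
import Summits.HodgeConjecture.HodgeConjecture.Theorems.PgOneCyclotomicSquaresTranscendental
import Literature.AlgebraicGeometry.Surfaces.K3TranscendentalHodgeIsometryAlgebraic
import Literature.AlgebraicGeometry.Surfaces.GeometricGenusOneAssociatedK3Surface

/-!
# Route MarkmanPartnerTransport · crux `PicardThreeK3Squares` (stmt-HodgeConjecture-19652) —
# the transcendental form of Buskin's theorem FROM Buskin's theorem:
# `Buskin2019_hodgeIsometry_algebraic → Huybrechts2019_transcendentalHodgeIsometry_algebraic`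

The named fact `Huybrechts2019_transcendentalHodgeIsometry_algebraic` (Huybrechts 2019 Cor. 0.4 (i) with
the Witt remark: a rational Hodge isometry `u : T(S′)_ℚ ⥲ T(S)_ℚ` between marked projective K3 surfaces
is induced on `T(S′)` by an algebraic class on `S × S′`; consumer: the `√6`-sector, `…SqrtSix`) REDUCES
to the tree's `Buskin2019_hodgeIsometry_algebraic` (the `H²` form) exactly as in print ("by Witt's
theorem"): read `u` in the markings as a rational isometric embedding `s : T′_ℚ → Λ_ℚ` of the rational
transcendental lattice `T′_ℚ = N′_ℚ^⊥` of `S′` (Lefschetz `(1,1)`, Hodge index), extend it to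
`σ ∈ O(Λ_ℚ)` (`WittExtension_holds`), complexify (`cxEnd`), and observe that `φ = η⁻¹ σ_ℂ η′` is a
rational Hodge isometry `H²(S′) ⥲ H²(S)` (`isRationalClass_markingConj`, `cupProduct_markingConj`,
`isOfHodgeType_markingConj`: `σ_ℂ` carries the period `x′` to `t·x` because `x′ ∈ T′ ⊗ ℂ` and `σ_ℂ = η u η′⁻¹`
there); Buskin gives the algebraic class, which acts as `φ = u` on `T(S′)`.

* `transcendentalHodgeIsometry_algebraic_of_buskin` — the reduction (so every consumer of the
  transcendental fact is a theorem modulo Buskin's Thm. 1.1 alone).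

No definition, no sorry. Prover seat hodge-nonav-19652-p1 (gen 4), `--supports stmt-HodgeConjecture-19652`.

References: D. Huybrechts, Comment. Math. Helv. 94 (2019), Cor. 0.4 (i) and the remark after Thm. 0.2;
N. Buskin, J. reine angew. Math. 755 (2019), Thm. 1.1, §6.2; J.-P. Serre, *A Course in Arithmetic* IV §1.5
(Witt).
-/

set_option linter.dupNamespace false

noncomputable section

namespace Summit.HodgeConjecture.HodgeConjecture.Theorems.MarkmanPartnerTransport.NikulinIsogeny

open scoped TensorProduct
open Module QuadraticMap CategoryTheory MonoidalCategory
open Literature.AlgebraicGeometry Literature.AlgebraicGeometry.Motives Literature.AlgebraicGeometry.HodgeTheory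
open Literature.AlgebraicGeometry.Surfaces
open Literature.AlgebraicTopology.SingularHomology
open Literature.NumberTheory.QuadraticForms
open Summit.HodgeConjecture.HodgeConjecture.Theorems
open Summit.HodgeConjecture.HodgeConjecture.Theorems.NikulinTwinTransport
open Summit.HodgeConjecture.HodgeConjecture.Theorems.AnchorExistenceCMFloor
open Summit.HodgeConjecture.HodgeConjecture.Theorems.MarkmanPartnerTransport.IsogenyInvariance

/-- **`Buskin2019_hodgeIsometry_algebraic → Huybrechts2019_transcendentalHodgeIsometry_algebraic`**
(Huybrechts 2019, remark after Thm. 0.2: "by Witt's theorem, there exists a Hodge isometry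
`H²(S,ℚ) ≅ H²(S′,ℚ)` if and only if there exists a Hodge isometry `T(S) ⊗ ℚ ≅ T(S′) ⊗ ℚ`" — the Witt
extension restricts to the given transcendental isometry). [cite: Huybrechts2019, Cor. 0.4 (i) and the remark after Thm. 0.2]
[cite: Buskin2019, Thm. 1.1 and §6.2] [cite: Serre1973, Ch. IV §1.5 Thm. 3] -/
theorem transcendentalHodgeIsometry_algebraic_of_buskin (hB : Buskin2019_hodgeIsometry_algebraic) :
    Huybrechts2019_transcendentalHodgeIsometry_algebraic := by
  classical
  intro S S' hS hS' η p x η' p' x' hM hM' u huT huonto hurat huiso huline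
  have h4 : 2 * 1 + 2 * 1 = 2 * 2 := rfl
  have hHT : Huybrechts_K3_hodgeTypes_H2 := Huybrechts_K3_hodgeTypes_H2_holds
  obtain ⟨hp₀, ⟨hpint, hpgen, hηint, hηcup, hx20, -⟩, -, hxpos, -⟩ := hM
  obtain ⟨hp'₀, ⟨hp'int, hp'gen, hη'int, hη'cup, hx'20, -⟩, -, hx'pos, -⟩ := hM'
  set N' := algebraicClasses S' 1 with hN'def
  have hsmul0' : ∀ {c : ℂ}, c • p' = 0 → c = 0 := fun h => by
    rcases smul_eq_zero.1 h with h | h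
    · exact h
    · exact absurd h hp'₀
  have hsmul0 : ∀ {c : ℂ}, c • p = 0 → c = 0 := fun h => by
    rcases smul_eq_zero.1 h with h | h
    · exact h
    · exact absurd h hp₀
  have hrat : ∀ c, IsRationalClass c ↔ ∃ w : K3Index → ℚ, η c = fun i => (w i : ℂ) :=
    isRationalClass_iff_of_marking hS η hηint
  have hrat' : ∀ c, IsRationalClass c ↔ ∃ w : K3Index → ℚ, η' c = fun i => (w i : ℂ) :=
    isRationalClass_iff_of_marking hS' η' hη'int
  -- the rational points of `N'` and `T' = N'_ℚ^⊥`
  let NQ : Submodule ℚ (K3Index → ℚ) :=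
    { carrier := {v | η'.symm (fun j => (v j : ℂ)) ∈ N'}
      add_mem' := fun {a b} ha hb => by
        simp only [Set.mem_setOf_eq, ratCastΛ_add, map_add]
        exact N'.add_mem ha hb
      zero_mem' := by
        simp only [Set.mem_setOf_eq, ratCastΛ_zero, map_zero]
        exact N'.zero_mem
      smul_mem' := fun q a ha => by
        simp only [Set.mem_setOf_eq, ratCastΛ_smul, map_smul]
        exact N'.smul_mem _ ha }
  have memNQ : ∀ v, v ∈ NQ ↔ η'.symm (fun j => (v j : ℂ)) ∈ N' := fun v => Iff.rfl
  have hL11 : ∀ c : complexBetti S' (2 * 1), IsRationalClass c → IsOfHodgeType 2 S' (2 * 1) 1 1 c → c ∈ N' :=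
    fun c hc h11 => lefschetzOneOne_rational_holds hS'.1 c hc h11
  have hND : ∀ c ∈ N', IsRationalClass c →
      (∀ d ∈ N', cupProduct (rfl : 2 * 1 + 2 * 1 = 2 * 2) c d = 0) → c = 0 :=
    fun c hcN hc hperp => anchorExistence_cmFloor_divisorClass_eq_zero_of_hodgeIndex
      hodgeIndex_surface_holds lefschetzOneOne_rational_holds
      Grothendieck1969_supportedClasses_le_hodgeConiveau_holds hS' hcN hc hperp
  have hspan := span_isRationalClass_eq_top_of_isSmoothProjective_holds.supportedClasses_eq_span
    hS'.1 (2 * 1) 1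
  have horth : ∀ v ∈ k3FormRat.orthogonal NQ, ∀ d ∈ N', k3Form (fun j => (v j : ℂ)) (η' d) = 0 := by
    intro v hv d hd
    rw [LinearMap.BilinForm.mem_orthogonal_iff] at hv
    have hd' : d ∈ Submodule.span ℂ {c : complexBetti S' (2 * 1) |
        IsRationalClass c ∧ c ∈ supportedClasses S' (2 * 1) 1} := by
      rw [← hspan]; exact hd
    clear hd
    induction hd' using Submodule.span_induction with
    | mem d hd =>
      obtain ⟨w', hw'⟩ := (hrat' d).1 hd.1
      have hwN : w' ∈ NQ := by
        rw [memNQ, ← hw', LinearEquiv.symm_apply_apply]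
        exact hd.2
      rw [hw', k3Form_ratCast, k3FormRat_isSymm.eq, hv w' hwN, Rat.cast_zero]
    | zero => rw [map_zero, k3Form_zero_right]
    | add c c' _ _ hc hc' => rw [map_add, k3Form_add_right, hc, hc', add_zero]
    | smul t c _ hc => rw [map_smul, k3Form_smul_right, hc, mul_zero]
  have hdisj : Disjoint NQ (k3FormRat.orthogonal NQ) := by
    rw [Submodule.disjoint_def]
    intro v hvN hvT
    have hc0 : η'.symm (fun j => (v j : ℂ)) = 0 :=
      hND _ ((memNQ v).1 hvN) ((hrat' _).2 ⟨v, LinearEquiv.apply_symm_apply _ _⟩) fun d hd => by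
        rw [hη'cup, LinearEquiv.apply_symm_apply, horth v hvT d hd, zero_smul]
    apply ratCastΛ_injective
    rw [ratCastΛ_zero]
    exact η'.symm.injective (hc0.trans (map_zero _).symm)
  have hc := isCompl_orthogonal hdisj
  set T := k3FormRat.orthogonal NQ with hTdef
  have hTnd : ∀ t ∈ T, (∀ t' ∈ T, k3FormRat t t' = 0) → t = 0 := by
    intro t ht hperp
    have hdisj' := disjoint_orthogonal_orthogonal hdisj
    rw [Submodule.disjoint_def] at hdisj'
    refine hdisj' t ht ?_
    rw [LinearMap.BilinForm.mem_orthogonal_iff]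
    intro t' ht'
    change k3FormRat t' t = 0
    rw [k3FormRat_isSymm.eq]
    exact hperp t' ht'
  -- `T`-coordinates ↔ `T(S')`
  have hTiff : ∀ y, y ∈ transcendentalSubspace S' ↔ ∀ d ∈ N', cupProduct h4 y d = 0 :=
    fun y ↦ mem_transcendentalSubspace_iff_forall_algebraicClasses hS'.1 y
  have hmemT : ∀ v ∈ T, η'.symm (fun i => (v i : ℂ)) ∈ transcendentalSubspace S' := by
    intro v hv
    rw [hTiff]
    intro d hd
    rw [hη'cup, LinearEquiv.apply_symm_apply, horth v hv d hd, zero_smul]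
  have hcoordT : ∀ v : K3Index → ℚ, η'.symm (fun i => (v i : ℂ)) ∈ transcendentalSubspace S' → v ∈ T := by
    intro v hv
    rw [hTiff] at hv
    rw [hTdef, LinearMap.BilinForm.mem_orthogonal_iff]
    intro n hn
    change k3FormRat n v = 0
    have h := hv _ ((memNQ n).1 hn)
    rw [hη'cup, LinearEquiv.apply_symm_apply, LinearEquiv.apply_symm_apply, k3Form_ratCast] at h
    rw [k3FormRat_isSymm.eq]
    exact_mod_cast hsmul0' h
  have hspanT : ∀ y ∈ transcendentalSubspace S',
      η' y ∈ Submodule.span ℂ (Set.range fun t : T => fun i => ((t : K3Index → ℚ) i : ℂ)) := by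
    intro y hy
    have hzN : ∀ n ∈ NQ, k3Form (η' y) (fun i => (n i : ℂ)) = 0 := by
      intro n hn
      have h := (hTiff y).1 hy _ ((memNQ n).1 hn)
      rw [hη'cup, LinearEquiv.apply_symm_apply] at h
      exact hsmul0' h
    have hz0 := cxEnd_projection_eq_zero hdisj hzN
    have h := iota_lam_of_proj_eq_zero (T := T) (hc := hc) hz0
    rw [← h]
    exact iota_mem_span T _
  -- `u` in coordinates: `s : T → Λ_ℚ`, `η (u (η'⁻¹ v)) = s v`
  have hE : ∀ t : T, ∃ w : K3Index → ℚ,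
      η (u (η'.symm (fun i => ((t : K3Index → ℚ) i : ℂ)))) = fun i => (w i : ℂ) := fun t ↦
    (hrat _).1 (hurat _ (hmemT _ t.2) ((hrat' _).2 ⟨_, LinearEquiv.apply_symm_apply _ _⟩))
  choose sf hsf using hE
  have hsadd : ∀ a b : T, sf (a + b) = sf a + sf b := fun a b ↦ by
    apply ratCastΛ_injective
    rw [ratCastΛ_add, ← hsf, ← hsf, ← hsf, ← map_add, ← map_add, ← map_add, Submodule.coe_add, ratCastΛ_add]
  have hssmul : ∀ (q : ℚ) (a : T), sf (q • a) = q • sf a := fun q a ↦ by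
    apply ratCastΛ_injective
    rw [ratCastΛ_smul, ← hsf, ← hsf, Submodule.coe_smul, ratCastΛ_smul, map_smul, map_smul, map_smul]
  let s₀ : T →ₗ[ℚ] (K3Index → ℚ) := { toFun := sf, map_add' := hsadd, map_smul' := hssmul }
  have hs₀ : ∀ t : T, s₀ t = sf t := fun t ↦ rfl
  -- `s` is isometric (for `k3FormRat`) and injective
  have hsiso : ∀ a b : T, k3FormRat (s₀ a) (s₀ b) = k3FormRat (a : K3Index → ℚ) (b : K3Index → ℚ) := by
    intro a b
    have h := huiso _ (hmemT _ a.2) _ (hmemT _ b.2)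
    rw [hsf, hsf, LinearEquiv.apply_symm_apply, LinearEquiv.apply_symm_apply, k3Form_ratCast, k3Form_ratCast] at h
    exact_mod_cast h
  set B : LinearMap.BilinForm ℚ (K3Index → ℚ) := k3FormRat with hBdef
  let s : (B.restrict T).Isometry B :=
    { toLinearMap := s₀
      map_app' := fun a b => by
        rw [LinearMap.BilinForm.restrict_apply]
        exact hsiso a b }
  have hsapp : ∀ t : T, s t = sf t := fun t ↦ rfl
  have hsinj : Function.Injective s := by
    intro a b hab
    have h0 : s₀ (a - b) = 0 := by
      change s (a - b) = 0
      rw [map_sub, hab, sub_self]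
    have hzero : (a - b : T) = 0 := by
      apply Subtype.ext
      apply hTnd _ (a - b).2
      intro t' ht'
      have h := hsiso (a - b) ⟨t', ht'⟩
      rw [h0, map_zero, LinearMap.zero_apply] at h
      exact h.symm
    exact sub_eq_zero.1 hzero
  -- Witt: extend `s` to `σL ∈ O(Λ_ℚ)`, complexify
  obtain ⟨σL, hσL⟩ := WittExtension_holds ℚ two_ne_zero (K3Index → ℚ) (K3Index → ℚ) B B
    k3FormRat_isSymm k3FormRat_isSymm k3FormRat_nondegenerate k3FormRat_nondegenerate
    (LinearMap.BilinForm.Equivalent.refl B) T s hsinj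
  set τ : Module.End ℚ (K3Index → ℚ) :=
    ((σL : (K3Index → ℚ) ≃ₗ[ℚ] (K3Index → ℚ)) : (K3Index → ℚ) →ₗ[ℚ] (K3Index → ℚ)) with hτ
  have hτapp : ∀ v, τ v = σL v := fun v => rfl
  have hτiso : ∀ v w, k3FormRat (τ v) (τ w) = k3FormRat v w := fun v w => by
    rw [hτapp, hτapp]
    exact σL.map_app w v
  have hτT : ∀ t : T, τ (t : K3Index → ℚ) = sf t := fun t ↦ by
    rw [hτapp]
    exact (hσL t).trans (hsapp t)
  set σ₀ : Module.End ℂ (K3Index → ℂ) := cxEnd τ with hσ₀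
  have hσ₀iso : ∀ a b, k3Form (σ₀ a) (σ₀ b) = k3Form a b := k3Form_cxEnd τ hτiso
  have hσ₀1 : ∀ a b, k3Form (σ₀ a) (σ₀ b) = 1 * k3Form a b := fun a b ↦ by rw [hσ₀iso, one_mul]
  have hσ₀rat : ∀ v : K3Index → ℤ, ∃ w : K3Index → ℚ, σ₀ (fun i => (v i : ℂ)) = fun i => (w i : ℂ) :=
    cxEnd_intCast τ
  -- `σ₀ ∘ η' = η ∘ u` on `T(S')`
  have hσ₀u : ∀ y ∈ transcendentalSubspace S', σ₀ (η' y) = η (u y) := by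
    intro y hy
    have hz := hspanT y hy
    have key : ∀ z ∈ Submodule.span ℂ (Set.range fun t : T => fun i => ((t : K3Index → ℚ) i : ℂ)),
        σ₀ z = η (u (η'.symm z)) := by
      intro z hz
      induction hz using Submodule.span_induction with
      | mem z hz =>
        obtain ⟨t, rfl⟩ := hz
        rw [hσ₀, cxEnd_ratCast, hτT t, ← hsf t]
      | zero => rw [map_zero, map_zero, map_zero, map_zero]
      | add a b _ _ ha hb => rw [map_add, ha, hb, map_add, map_add, map_add]
      | smul c a _ ha => rw [map_smul, ha, map_smul, map_smul, map_smul]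
    rw [key _ hz, LinearEquiv.symm_apply_apply]
  -- the period: `σ₀ x' = t • x`
  have hω'T : η'.symm x' ∈ transcendentalSubspace S' :=
    (mem_transcendentalSubspace_iff_forall_algebraicClasses hS'.1 _).2
      fun d hd ↦ PgOneCyclotomicSquares.cup_eq_zero_of_twoZero hS'.1 hx'20 hd
  have hper : ∃ t : ℂ, σ₀ x' = t • x := by
    obtain ⟨t, ht⟩ := huline
    refine ⟨t, ?_⟩
    have h := hσ₀u _ hω'T
    rw [LinearEquiv.apply_symm_apply, ht, map_smul, LinearEquiv.apply_symm_apply] at h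
    exact h
  -- Buskin for `φ = η⁻¹ σ₀ η'`
  set φ : complexBetti S' (2 * 1) →ₗ[ℂ] complexBetti S (2 * 1) :=
    η.symm.toLinearMap ∘ₗ σ₀ ∘ₗ η'.toLinearMap with hφdef
  have hφapp : ∀ y, φ y = η.symm (σ₀ (η' y)) := fun y ↦ rfl
  obtain ⟨γ, hγalg, hγ⟩ := hB complexOrientationFamily (OrientationFamily.hasPoincareDuality _) S S' hS hS'
    p p' ⟨hpint, hpgen⟩ ⟨hp'int, hp'gen⟩ φ
    (fun y hy ↦ by rw [hφapp]; exact isRationalClass_markingConj η η' σ₀ hS hS' hηint hη'int hσ₀rat hy)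
    (fun i j y hy ↦ by
      rw [hφapp]
      exact isOfHodgeType_markingConj η p x η' p' x' σ₀ hHT hS hS' hηint hηcup hx20 hxpos hη'int hη'cup
        hp'₀ hx'20 hx'pos hσ₀rat one_ne_zero hσ₀1 hper i j y hy)
    (fun a b c h ↦ by
      rw [hφapp, hφapp]
      have h1 := cupProduct_markingConj η p η' p' σ₀ hp'₀ hηcup hη'cup hσ₀1 a b c h
      rwa [one_mul] at h1)
  refine ⟨γ, hγalg, fun y hy ↦ ?_⟩
  rw [← hγ y, hφapp, hσ₀u y hy, LinearEquiv.symm_apply_apply]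

end Summit.HodgeConjecture.HodgeConjecture.Theorems.MarkmanPartnerTransport.NikulinIsogeny

end
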